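/-
Copyright (c) 2026 the pub-hodgecm-mathlib formalisation cell (harness21).  Prover seat hodgecm-mathlib-K2E3-p12 (g3), Track B «K2-LIT» ∕ h413
(`stmt-HodgeConjecture-24833`), line `K2_E3_EllipticInputs`, unit U12-d, row 12: the first ANALYTIC leaf of the Lie-algebra core (L-B_GL) at `N = 2` —
`Y ↦ |disc χ_Y|_F^{-1∕2}` IS LOCALLY INTEGRABLE ON `𝔤𝔩₂(F)`.  2026-09-04.
-/
import Summits.HodgeConjecture.HodgeConjecture.Theorems.K2E3DiagonalFormInvSqrtIntegrable            -- ★ (this seat): `lintegral_piPrimePowBall_sqrt_normAbs_inv_lt_top`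
import Summits.HodgeConjecture.HodgeConjecture.Theorems.K2E3NormalizedCharBddNearSemisimpleRegular  -- ★ p855019 (K2E3-p12 g0): `continuous_discr_charpoly`
import Mathlib.LinearAlgebra.Matrix.Charpoly.Disc
import Mathlib.MeasureTheory.Measure.Haar.Unique
import Mathlib.Topology.Instances.Matrix
import HarnessLib

/-!
# K2_E3 road (h413), unit U12-d — `|disc χ_Y|_F^{-1∕2} = |η_{𝔤𝔩₂}(Y)|^{-1∕2}` is locally integrable on `𝔤𝔩₂(F)`

Cell `pub/hodgecm-mathlib` (D-0151), Track B (21-frontier RULING «PUSH BOTH» 2026-09-03, director req624), seat K2E3-p12 (g3), lineage of row 12; dealer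
K2E3-plan (g2) deal (D12) 2026-09-04T01:19:47Z, self-deal (ii) GO.  `--supports stmt-HodgeConjecture-24833 --as helper`; THEOREMS ONLY (no definition ∕ instance ∕
notation ∕ named fact ∕ `sorry`); never imports `Cruxes/…/Lines`.

The Lie-algebra core (L-B_GL) of row 12 (`subsig_K2E3GLnNilpotentFourierRegular` = Harish-Chandra's Thm. 4.4 for `J(𝒩)` on `𝔤𝔩_N(F)`) says that the Fourier transform of a
nilpotent-supported invariant distribution is a LOCALLY INTEGRABLE function `F_T` with `|η|^{1∕2} F_T` locally bounded.  At `N = 2` (`J(𝒩) = ℂ δ₀ ⊕ ℂ μ_{𝒪_reg}`) the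
function `μ̂_{𝒪_reg}` is `|disc χ_Y|_F^{-1∕2}` on the split regular set up to locally constant factors [HarishChandra1999, Thm. 6.1, Thm. 7.5 (rank one)], so the first
honest analytic input is **`|disc χ_Y|_F^{-1∕2} ∈ L¹_loc(𝔤𝔩₂(F))`** — also the integrability input of the Weyl-integration ∕ van Dijk road for principal series.  Proof:
* §1 `discr_charpoly_eq_ternaryForm` — `disc χ_Y = (Y₀₀ − Y₁₁)² + (Y₀₁ + Y₁₀)² − (Y₀₁ − Y₁₀)²` (Mathlib `Matrix.discr_fin_two`): in the linear coordinates
  `(u, s, t, a) = (Y₀₀ − Y₁₁, Y₀₁ + Y₁₀, Y₀₁ − Y₁₀, Y₀₀)` the discriminant is the DIAGONAL NON-DEGENERATE TERNARY FORM `u² + s² − t²` (invertible change when `2 ≠ 0`);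
* §2 `lintegral_isCompact_sqrt_normAbs_discr_inv_lt_top` — `∫⁻_C (√|disc χ_Y|_F)⁻¹ dμ𝔤 < ∞` for every compact `C ⊂ 𝔤𝔩₂(F)` and every additive Haar `μ𝔤`: transport along the
  linear homeomorphism `𝔤𝔩₂(F) ≃ F³ × F`, uniqueness of Haar measure (Mathlib `isAddLeftInvariant_eq_smul`), a box `(𝔭^{n₀})³ × 𝔭^{n₀} ⊇` the image of `C`, and
  ★ `lintegral_piPrimePowBall_sqrt_normAbs_inv_lt_top` (Weil 1965 Prop. 6 fibre density) on the `F³` factor;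
* §3 **`locallyIntegrable_sqrt_normAbs_discr_inv`** — `LocallyIntegrable (fun Y ↦ ((√|disc χ_Y|_F)⁻¹ : ℝ)) μ𝔤` (`F` of characteristic `0` with a continuous non-trivial `ψ`,
  e.g. `F = L_w` with Tate's `ψ_w`; the weight is `0` on the singular locus, a null set anyway).
[HarishChandra1999AdmissibleDistributions, Thm. 4.4 p. 11, Thm. 6.1 p. 45] [Weil1965, Chap. III n° 36 Prop. 6] [Igusa1978, Ch. II §7].
HONEST LABEL: HC_CM is proved only modulo the 7 printed citations (2 remaining named inputs: hLiu418 = stmt-HodgeConjecture-24832, h413 =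
stmt-HodgeConjecture-24833) until rung 0 closes; count-neutral helper — (L-B_GL) at `N = 2` still needs `J(𝒩) = ℂδ₀ ⊕ ℂμ_reg` and the explicit `μ̂_reg`.

## References
* [HarishChandra1999AdmissibleDistributions] Harish-Chandra (DeBacker–Sally), *Admissible Invariant Distributions on Reductive p-adic Groups* (1999), Thm. 4.4, Thm. 6.1.
* [Weil1965] A. Weil, *Sur la formule de Siegel dans la théorie des groupes classiques*, Acta Math. 113 (1965), Chap. III n° 36, Prop. 6.
* [Igusa1978] J.-I. Igusa, *Lectures on Forms of Higher Degree*, Tata Institute (1978), Ch. II §7.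
-/

set_option autoImplicit false
set_option linter.dupNamespace false   -- `Summit.HodgeConjecture.HodgeConjecture.…` (D-0017 nested layout; lakefile exemption for Summits)

noncomputable section

open MeasureTheory Measure Filter Topology Set
open scoped NNReal ENNReal Matrix
open Literature.NumberTheory.Automorphic Literature.NumberTheory.Automorphic.LocalFieldHaar
open Literature.NumberTheory.GaloisRepresentations Literature.NumberTheory.GaloisRepresentations.IsNonarchimedeanLocalField
open Summit.HodgeConjecture.HodgeConjecture.Cruxes.H413.K2E3DiagonalFormInvSqrtIntegrable

namespace Summit.HodgeConjecture.HodgeConjecture.Cruxes.H413.K2E3GL2DiscrInvSqrtLocallyIntegrable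

variable {F : Type*} [Field F] [ValuativeRel F] [TopologicalSpace F] [IsNonarchimedeanLocalField F]

/-! ## §1  `disc χ_Y` on `𝔤𝔩₂` is a diagonal ternary form in linear coordinates -/

omit [ValuativeRel F] [TopologicalSpace F] [IsNonarchimedeanLocalField F] in
/-- `disc χ_Y = (tr Y)² − 4 det Y = (Y₀₀ − Y₁₁)² + (Y₀₁ + Y₁₀)² − (Y₀₁ − Y₁₀)²` — the value of the diagonal form `z₀² + z₁² − z₂²` (coefficients `![1, 1, -1]`) at
`(Y₀₀ − Y₁₁, Y₀₁ + Y₁₀, Y₀₁ − Y₁₀)`. [cite: HarishChandra1999AdmissibleDistributions, Thm. 7.5 p. 51 (rank one)] -/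
theorem discr_charpoly_eq_ternaryForm (Y : Matrix (Fin 2) (Fin 2) F) :
    Y.charpoly.discr = ∑ i : Fin 3, (![(1 : F), 1, -1] i) * (![Y 0 0 - Y 1 1, Y 0 1 + Y 1 0, Y 0 1 - Y 1 0] i) ^ 2 := by
  have h : Y.charpoly.discr = Y.trace ^ 2 - 4 * Y.det := Matrix.discr_fin_two Y
  rw [h, Matrix.trace_fin_two, Matrix.det_fin_two, Fin.sum_univ_three]
  simp only [Matrix.cons_val_zero, Matrix.cons_val_one, Matrix.cons_val_two, Matrix.head_cons, Matrix.tail_cons]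
  ring

/-! ## §2  `∫⁻_C (√|disc χ_Y|)⁻¹ dμ𝔤 < ∞` on compact sets -/

set_option maxHeartbeats 1600000 in
/-- **`∫⁻_C (√|disc χ_Y|_F)⁻¹ dμ𝔤 < ∞` for every compact `C ⊂ 𝔤𝔩₂(F)`** (`2 ≠ 0`, `F` with a continuous non-trivial `ψ`, `μ𝔤` any additive Haar measure): transport
to `F³ × F` along `Y ↦ ((Y₀₀ − Y₁₁, Y₀₁ + Y₁₀, Y₀₁ − Y₁₀), Y₀₀)`, Haar uniqueness, and ★ `lintegral_piPrimePowBall_sqrt_normAbs_inv_lt_top` on a box containing the image.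
[cite: Weil1965, Chap. III n° 36 Prop. 6, p. 54] [cite: HarishChandra1999AdmissibleDistributions, Thm. 4.4 p. 11] -/
theorem lintegral_isCompact_sqrt_normAbs_discr_inv_lt_top {ψ : AddChar F Circle} (hψ : ψ.IsContinuousNontrivial) (h2 : (2 : F) ≠ 0)
    [MeasurableSpace (Matrix (Fin 2) (Fin 2) F)] [BorelSpace (Matrix (Fin 2) (Fin 2) F)] (μ𝔤 : Measure (Matrix (Fin 2) (Fin 2) F)) [μ𝔤.IsAddHaarMeasure]
    {C : Set (Matrix (Fin 2) (Fin 2) F)} (hC : IsCompact C) :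
    ∫⁻ Y in C, (((NNReal.sqrt (normAbs F Y.charpoly.discr))⁻¹ : ℝ≥0) : ℝ≥0∞) ∂μ𝔤 < ∞ := by
  classical
  haveI : T2Space F := (isLocalField F).toT2Space
  haveI : LocallyCompactSpace F := (isLocalField F).toLocallyCompactSpace
  haveI : SecondCountableTopology F := secondCountableTopology_localField F
  letI mF : MeasurableSpace F := borel F
  haveI : BorelSpace F := ⟨rfl⟩
  set μ : Measure F := Measure.addHaar with hμ
  -- the linear homeomorphism `e : 𝔤𝔩₂(F) ≃ F³ × F`
  have h22 : (2 : F)⁻¹ * 2 = 1 := inv_mul_cancel₀ h2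
  let eA : Matrix (Fin 2) (Fin 2) F ≃+ ((Fin 3 → F) × F) :=
    { toFun := fun Y => (![Y 0 0 - Y 1 1, Y 0 1 + Y 1 0, Y 0 1 - Y 1 0], Y 0 0)
      invFun := fun z => !![z.2, (2 : F)⁻¹ * (z.1 1 + z.1 2); (2 : F)⁻¹ * (z.1 1 - z.1 2), z.2 - z.1 0]
      left_inv := fun Y => by
        ext i j
        fin_cases i <;> fin_cases j
        · rfl
        · simp only [Matrix.cons_val_one, Matrix.cons_val_two, Matrix.head_cons, Matrix.tail_cons, Matrix.of_apply, Matrix.cons_val',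
            Matrix.cons_val_zero, Matrix.cons_val_fin_one, Fin.mk_one, Fin.zero_eta]
          linear_combination (Y 0 1) * h22
        · simp only [Matrix.cons_val_one, Matrix.cons_val_two, Matrix.head_cons, Matrix.tail_cons, Matrix.of_apply, Matrix.cons_val',
            Matrix.cons_val_zero, Matrix.cons_val_fin_one, Fin.mk_one, Fin.zero_eta]
          linear_combination (Y 1 0) * h22
        · simp only [Matrix.cons_val_zero, Matrix.of_apply, Matrix.cons_val', Matrix.cons_val_one, Matrix.cons_val_fin_one,
            Fin.mk_one, sub_sub_cancel]
      right_inv := fun z => by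
        refine Prod.ext (funext fun i => ?_) ?_
        · fin_cases i
          · simp
          · simp only [Fin.mk_one, Matrix.cons_val_one, Matrix.of_apply, Matrix.cons_val', Matrix.cons_val_zero,
              Matrix.cons_val_fin_one]
            linear_combination (z.1 1) * h22
          · simp only [Matrix.cons_val_two, Matrix.tail_cons, Matrix.head_cons, Matrix.of_apply, Matrix.cons_val', Matrix.cons_val_zero,
              Matrix.cons_val_one, Matrix.cons_val_fin_one, Fin.reduceFinMk]
            linear_combination (z.1 2) * h22
        · simp
      map_add' := fun Y Z => by
        refine Prod.ext (funext fun i => ?_) (by simp)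
        fin_cases i <;> simp <;> ring }
  have h00 : Continuous fun Y : Matrix (Fin 2) (Fin 2) F => Y 0 0 := continuous_id.matrix_elem 0 0
  have h01 : Continuous fun Y : Matrix (Fin 2) (Fin 2) F => Y 0 1 := continuous_id.matrix_elem 0 1
  have h10 : Continuous fun Y : Matrix (Fin 2) (Fin 2) F => Y 1 0 := continuous_id.matrix_elem 1 0
  have h11 : Continuous fun Y : Matrix (Fin 2) (Fin 2) F => Y 1 1 := continuous_id.matrix_elem 1 1
  have he' : Continuous fun Y : Matrix (Fin 2) (Fin 2) F => ((![Y 0 0 - Y 1 1, Y 0 1 + Y 1 0, Y 0 1 - Y 1 0] : Fin 3 → F), Y 0 0) := by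
    refine continuous_prodMk.2 ⟨continuous_pi fun i => ?_, h00⟩
    fin_cases i
    · simp only [Fin.zero_eta, Matrix.cons_val_zero]; exact h00.sub h11
    · simp only [Fin.mk_one, Matrix.cons_val_one]; exact h01.add h10
    · simp only [Fin.reduceFinMk, Matrix.cons_val_two, Matrix.tail_cons, Matrix.head_cons]; exact h01.sub h10
  have he : Continuous eA := he'
  have hz1 : ∀ i : Fin 3, Continuous fun z : (Fin 3 → F) × F => z.1 i := fun i => (continuous_apply i).comp continuous_fst
  have hesymm' : Continuous fun z : (Fin 3 → F) × F => !![z.2, (2 : F)⁻¹ * (z.1 1 + z.1 2); (2 : F)⁻¹ * (z.1 1 - z.1 2), z.2 - z.1 0] := by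
    refine continuous_matrix fun i j => ?_
    fin_cases i <;> fin_cases j
    · simp only [Matrix.of_apply, Matrix.cons_val', Matrix.cons_val_fin_one]; exact continuous_snd
    · simp only [Matrix.of_apply, Matrix.cons_val', Matrix.cons_val_fin_one]
      exact continuous_const.mul ((hz1 1).add (hz1 2))
    · simp only [Matrix.of_apply, Matrix.cons_val', Matrix.cons_val_fin_one]
      exact continuous_const.mul ((hz1 1).sub (hz1 2))
    · simp only [Matrix.of_apply, Matrix.cons_val', Matrix.cons_val_fin_one]
      exact continuous_snd.sub (hz1 0)
  have hesymm : Continuous eA.symm := hesymm'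
  let eH : Matrix (Fin 2) (Fin 2) F ≃ₜ ((Fin 3 → F) × F) := Homeomorph.mk eA.toEquiv he hesymm
  let em : Matrix (Fin 2) (Fin 2) F ≃ᵐ ((Fin 3 → F) × F) := eH.toMeasurableEquiv
  have hem : ∀ Y, em Y = eA Y := fun Y => rfl
  -- the transported measure is Haar, hence a multiple of the product Haar measure `ν₀`
  haveI : (μ𝔤.map eA).IsAddHaarMeasure := AddEquiv.isAddHaarMeasure_map μ𝔤 eA he hesymm
  set ν₀ : Measure ((Fin 3 → F) × F) := (Measure.pi fun _ : Fin 3 => μ).prod μ with hν₀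
  haveI : ν₀.IsAddHaarMeasure := by rw [hν₀]; infer_instance
  have hsmul : μ𝔤.map eA = addHaarScalarFactor (μ𝔤.map eA) ν₀ • ν₀ := isAddLeftInvariant_eq_smul _ _
  -- the image of `C` lies in a box
  have hCc : IsCompact (eA '' C) := hC.image he
  obtain ⟨n₀, hn₀⟩ : ∃ n : ℕ, eA '' C ⊆ piPrimePowBall F (Fin 3) (-(n : ℤ)) ×ˢ primePowBall F (-(n : ℤ)) := by
    have hcover : eA '' C ⊆ ⋃ n : ℕ, piPrimePowBall F (Fin 3) (-(n : ℤ)) ×ˢ primePowBall F (-(n : ℤ)) := by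
      intro z _
      obtain ⟨k₁, hk₁⟩ := exists_mem_piPrimePowBall z.1
      obtain ⟨k₂, hk₂⟩ := exists_mem_piPrimePowBall (fun _ : Fin 1 => z.2)
      refine Set.mem_iUnion.2 ⟨max k₁ k₂, Set.mk_mem_prod (piPrimePowBall_antitone (by omega) hk₁) ?_⟩
      exact primePowBall_antitone (by omega) (mem_piPrimePowBall_iff.1 hk₂ 0)
    have hdir : Directed (· ⊆ ·) fun n : ℕ => piPrimePowBall F (Fin 3) (-(n : ℤ)) ×ˢ primePowBall F (-(n : ℤ)) :=
      Monotone.directed_le fun a b hab => Set.prod_mono (piPrimePowBall_antitone (by omega)) (primePowBall_antitone (by omega))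
    exact hCc.elim_directed_cover _ (fun n => (isOpen_piPrimePowBall _).prod (isOpen_primePowBall _)) hcover hdir
  set Bx : Set ((Fin 3 → F) × F) := piPrimePowBall F (Fin 3) (-(n₀ : ℤ)) ×ˢ primePowBall F (-(n₀ : ℤ)) with hBx
  have hBxm : MeasurableSet Bx := (measurableSet_piPrimePowBall _).prod (measurableSet_primePowBall _)
  -- the weight in the new coordinates
  set c : Fin 3 → F := ![(1 : F), 1, -1] with hc
  have hc0 : ∀ i, c i ≠ 0 := fun i => by fin_cases i <;> simp [hc]
  set W : ((Fin 3 → F) × F) → ℝ≥0∞ := fun z => (((NNReal.sqrt (normAbs F (∑ i, c i * z.1 i ^ 2)))⁻¹ : ℝ≥0) : ℝ≥0∞) with hW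
  have hWe : ∀ Y : Matrix (Fin 2) (Fin 2) F, W (eA Y) = (((NNReal.sqrt (normAbs F Y.charpoly.discr))⁻¹ : ℝ≥0) : ℝ≥0∞) := by
    intro Y
    simp only [hW, hc, discr_charpoly_eq_ternaryForm Y]
    rfl
  have hQc : Continuous fun z : (Fin 3 → F) × F => ∑ i, c i * z.1 i ^ 2 :=
    continuous_finsetSum _ fun i _ => continuous_const.mul (((continuous_apply i).comp continuous_fst).pow 2)
  have hWm : Measurable W :=
    ENNReal.continuous_coe.measurable.comp ((NNReal.continuous_sqrt.comp (continuous_normAbs.comp hQc)).measurable.inv)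
  -- transport: `∫⁻_C w dμ𝔤 = ∫⁻ 1_{eC} W d(map e μ𝔤)`
  have hstep1 : ∫⁻ Y in C, (((NNReal.sqrt (normAbs F Y.charpoly.discr))⁻¹ : ℝ≥0) : ℝ≥0∞) ∂μ𝔤 = ∫⁻ z, (eA '' C).indicator W z ∂(μ𝔤.map eA) := by
    rw [show (μ𝔤.map eA) = μ𝔤.map em from rfl, lintegral_map_equiv, ← lintegral_indicator hC.measurableSet]
    refine lintegral_congr fun Y => ?_
    rw [hem]
    by_cases hY : Y ∈ C
    · rw [Set.indicator_of_mem hY, Set.indicator_of_mem (Set.mem_image_of_mem _ hY), hWe]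
    · rw [Set.indicator_of_notMem hY, Set.indicator_of_notMem (fun h => hY ?_)]
      obtain ⟨Y', hY', hYY'⟩ := h
      rwa [← eA.injective hYY']
  rw [hstep1, hsmul, lintegral_smul_measure]
  refine ENNReal.mul_lt_top ENNReal.coe_lt_top ?_
  -- bound by the box integral, which factors
  calc ∫⁻ z, (eA '' C).indicator W z ∂ν₀ ≤ ∫⁻ z, Bx.indicator W z ∂ν₀ := lintegral_mono fun z => Set.indicator_le_indicator_of_subset hn₀ (fun _ => zero_le) z
    _ = ∫⁻ z in Bx, W z ∂ν₀ := lintegral_indicator hBxm _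
    _ = (∫⁻ x in piPrimePowBall F (Fin 3) (-(n₀ : ℤ)), (((NNReal.sqrt (normAbs F (∑ i, c i * x i ^ 2)))⁻¹ : ℝ≥0) : ℝ≥0∞) ∂(Measure.pi fun _ : Fin 3 => μ)) *
          μ (primePowBall F (-(n₀ : ℤ))) := by
        rw [hBx, hν₀, ← Measure.prod_restrict]
        have hfm : Measurable fun x : Fin 3 → F => (((NNReal.sqrt (normAbs F (∑ i, c i * x i ^ 2)))⁻¹ : ℝ≥0) : ℝ≥0∞) :=
          ENNReal.continuous_coe.measurable.comp ((NNReal.continuous_sqrt.comp (continuous_normAbs.comp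
            (continuous_finsetSum _ fun i _ => continuous_const.mul ((continuous_apply i).pow 2)))).measurable.inv)
        have h := lintegral_prod_mul (μ := (Measure.pi fun _ : Fin 3 => μ).restrict (piPrimePowBall F (Fin 3) (-(n₀ : ℤ))))
          (ν := μ.restrict (primePowBall F (-(n₀ : ℤ))))
          (f := fun x : Fin 3 → F => (((NNReal.sqrt (normAbs F (∑ i, c i * x i ^ 2)))⁻¹ : ℝ≥0) : ℝ≥0∞)) (g := fun _ => 1)
          hfm.aemeasurable aemeasurable_const
        simp only [mul_one, lintegral_const, Measure.restrict_apply_univ, one_mul] at h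
        exact h
    _ < ∞ := ENNReal.mul_lt_top (lintegral_piPrimePowBall_sqrt_normAbs_inv_lt_top μ hψ h2 hc0 (by simp) _) (measure_primePowBall_lt_top μ _)

/-! ## §3  Local integrability -/

/-- **`Y ↦ |disc χ_Y|_F^{-1∕2}` IS LOCALLY INTEGRABLE ON `𝔤𝔩₂(F)`** (`F` a non-archimedean local field of characteristic `0` carrying a continuous non-trivial additive
character, `μ𝔤` any additive Haar measure; the weight `(√|disc χ_Y|_F)⁻¹ ∈ ℝ≥0` is `0` on the singular locus).  The `N = 2` integrability input of the Lie-algebra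
core (L-B_GL) «`T̂ = F_T ∈ L¹_loc`, `|η|^{1∕2} F_T` locally bounded» for the regular nilpotent orbit of `𝔤𝔩₂`.
[cite: HarishChandra1999AdmissibleDistributions, Thm. 4.4 p. 11, Thm. 6.1 p. 45] [cite: Weil1965, Chap. III n° 36 Prop. 6] [cite: Igusa1978, Ch. II §7 Thm. 1] -/
theorem locallyIntegrable_sqrt_normAbs_discr_inv [CharZero F] {ψ : AddChar F Circle} (hψ : ψ.IsContinuousNontrivial)
    [MeasurableSpace (Matrix (Fin 2) (Fin 2) F)] [BorelSpace (Matrix (Fin 2) (Fin 2) F)] (μ𝔤 : Measure (Matrix (Fin 2) (Fin 2) F)) [μ𝔤.IsAddHaarMeasure] :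
    LocallyIntegrable (fun Y : Matrix (Fin 2) (Fin 2) F => (((NNReal.sqrt (normAbs F Y.charpoly.discr))⁻¹ : ℝ≥0) : ℝ)) μ𝔤 := by
  haveI : T2Space F := (isLocalField F).toT2Space
  haveI : LocallyCompactSpace F := (isLocalField F).toLocallyCompactSpace
  haveI : LocallyCompactSpace (Matrix (Fin 2) (Fin 2) F) := Pi.locallyCompactSpace_of_finite
  have hmeas : Measurable fun Y : Matrix (Fin 2) (Fin 2) F => (((NNReal.sqrt (normAbs F Y.charpoly.discr))⁻¹ : ℝ≥0) : ℝ) :=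
    measurable_coe_nnreal_real.comp ((NNReal.continuous_sqrt.comp (continuous_normAbs.comp
      K2E3NormalizedCharBddNearSemisimpleRegular.continuous_discr_charpoly)).measurable.inv)
  rw [locallyIntegrable_iff]
  intro C hC
  refine ⟨hmeas.aestronglyMeasurable.restrict, ?_⟩
  rw [hasFiniteIntegral_iff_enorm]
  have h := lintegral_isCompact_sqrt_normAbs_discr_inv_lt_top hψ two_ne_zero μ𝔤 hC
  refine lt_of_le_of_lt (le_of_eq (lintegral_congr fun Y => ?_)) h
  rw [Real.enorm_eq_ofReal (NNReal.coe_nonneg _), ENNReal.ofReal_coe_nnreal]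

end Summit.HodgeConjecture.HodgeConjecture.Cruxes.H413.K2E3GL2DiscrInvSqrtLocallyIntegrable

end
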